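import Literature.NumberTheory.Automorphic.UnitaryThreeBorelCosetCountQuadratic
import Literature.NumberTheory.LocalFields.UnramifiedQuadraticNormShiftedCounts
import HarnessLib

/-!
# Flicker's Prop. 13, cases (b)∕(d), AS A COSET COUNT over the CORE-0 criterion: `#{y ∈ P_H ⧸ (P_H ∩ H^K_m) : y⁻¹ τ₀ y ∈ H^K_m} = F · q^{m−k} q^{m−1}(q+1) · q^{m−k}`
(Flicker (1998), *Elementary proof of the fundamental lemma for a unitary group*, Prop. 13 pp. 91–93, cases (b) and (d); Prop. 8 p. 84)

Topic `NumberTheory/Automorphic` (road «D-N7-inert», MAP v3 (F8) PROP. 13, LAYER B (13-ii) COUNT-0); namespace `Literature.NumberTheory.Automorphic.UnitaryGroup`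
(B-p17 (g24)'s frame, ★ `flickerPH`∕`flickerHK`∕`flickerPH0`, ★ B-p04 (g33) `flickerPHRho` (H1)(H3), ★ A-p03 (g24) `UnitaryThreeBorelCosetCountQuadratic` TEMPLATE).
THEOREMS ONLY: no definition, no named fact, no instance, no notation, no `sorry`; kernel lane.  Pen F0P3b-p01 (g6) under A-p03 (g24) pen 1 (LEAD F0P3a-plan (g9) T8-70
(C); census `F0/P3/F0P3b-p01/g6/CENSUS-F8-Prop13-CountZero-X1.F0P3bp01g6.md`).  HC_CM is proved only modulo the 2 remaining named inputs (hLiu418, h413) until rung 0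
closes; this file is group bookkeeping over a valued field and pays no letter by itself.

THE MATHEMATICS [Flicker1998UnitaryFL, Prop. 13 p. 92–93, cases (b)∕(d)].  On the `θ̄ = 0 = j` stratum the conjugation condition «`p⁻¹ τ₀ p ∈ H^K_m`» for
`p = p(u, x, w) ∈ P_H` becomes, in the regime of the printed cases (b)∕(d) (`[N∕2] + 1 ≤ m ≤ [M∕2]`), the pair of congruences
**`|(uσu)⁻¹ + e| ≤ |ϖ^k|` and `|x| ≤ |ϖ^k|`**, `k = m − [N∕2]`, `e = (A − b)∕B` a `σ`-fixed UNIT (p. 92–93: «`Δ = (uū)⁻¹ ∈ −x + π^{m−[N∕2]}R` and `λ ∈ π^{m−[N∕2]}R`»;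
the tree's CORE-0 criterion `conditions_iff_small_of_le`, p04 (g12)).  This file takes that criterion as the BINDER `hbd` (values-abstract: the statement of CORE-0 is
not yet ★) and COUNTS: through B-p04's reduction `ρ_m` (constant fibres `F = [N₀(ϖ^m) : P_H ∩ H^K_m]`, binder `hfib`, as in ★ `natCard_cosets_regime_four`) the good
cosets are `F` times the pairs `(ū, x̄) ∈ (𝒪⧸𝓂^m)²` with `ū σ̄ū ≡ −e⁻¹ (mod 𝓂^k)`, `σ̄x̄ = −x̄`, `x̄ ≡ 0 (mod 𝓂^k)` — counted by ★ `natCard_pairs_norm_congr_antifixed_zero`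
(FILE 6 of `UnramifiedQuadraticNorm*`): **`F · (q^{m−k} · q^{m−1}(q+1)) · q^{m−k}`**; with `F = q^m` ((H2), B-p04 FILE C) and `k = m − [N∕2]` this is Flicker's
`(1 + q⁻¹) q^{2m+2[N∕2]}` = ★ `iThirteen`'s branches (b)∕(d) (ℚ-cast ★ `natCast_count_b_eq`).
* §1 the dictionary `|(uσu)⁻¹ + e| ≤ |ϖ^k| ↔ φ_k(ā σ̄ā) = −ē⁻¹` for a unit `a` with `N(a) = uσu` (`v_inv_add_le_iff_factor_norm_eq`).
* §2 **`natCard_cosets_of_iff_small`** — the coset count over the binder `hbd`.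
NOT here: the regimes «all» ∕ «none» (★ `natCard_cosets_eq_index_of_forall` ∕ `_eq_zero_of_forall_not` apply verbatim to CORE-0's (R-a)/(R-kill)/(R-far)), the (c)∕(e)
norm-residue count, the packaging `(Nat.card … : ℚ) = iThirteen …`.

## References
* [Flicker1998UnitaryFL] Y. Z. Flicker, *Elementary proof of the fundamental lemma for a unitary group*, Canad. J. Math. 50 (1998), 74–98: Prop. 13 pp. 91–93, Prop. 8 p. 84.
* [Rogawski1990] J. D. Rogawski, *Automorphic Representations of Unitary Groups in Three Variables* (1990), §4.9 p. 55.
-/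

set_option autoImplicit false

open scoped MatrixGroups WithZero Valued
open Matrix

namespace Literature.NumberTheory.Automorphic

namespace UnitaryGroup

open Literature.NumberTheory.Automorphic.HermitianLattice (unitaryInt mem_unitaryInt_iff LocalConjDatum)
open Literature.NumberTheory.LocalFields.UnramifiedQuadraticNorm IsLocalRing

variable {K : Type*} [Field K] [Valued K ℤᵐ⁰] {ϖ : K} (σ : K →+* K) {J : Matrix (Fin 3) (Fin 3) K}

/-! ## §1 The dictionary for `|n⁻¹ + e| ≤ |ϖ^k|` -/

/-- **`|(aσa)⁻¹ + e| ≤ |ϖ^k| ↔ ā σ̄ā ≡ r (mod 𝓂^k)`** for integers `a`, `e` of valuation one and `r ∈ 𝒪` with `r·e = −1` (`n = aσa` is a unit, `n⁻¹ + e = n⁻¹(1 + en)`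
and `1 + en = e(n − r)`), read on the class of `a` modulo `𝓂^m` (`k ≤ m`). [cite: Flicker1998UnitaryFL, Prop. 13 p. 93] -/
theorem v_inv_add_le_iff_factor_norm_eq (hd : LocalConjDatum σ ϖ) (hσO : ∀ y : 𝒪[K], (σ.comp 𝒪[K].subtype) y ∈ 𝒪[K])
    {k m : ℕ} (hkm : k ≤ m) {a e : K} (ha : Valued.v a = 1) (he : Valued.v e = 1) (r : 𝒪[K]) (hr : (r : K) * e = -1) :
    Valued.v ((a * σ a)⁻¹ + e) ≤ Valued.v (ϖ ^ k) ↔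
      Ideal.Quotient.factor (Ideal.pow_le_pow_right hkm)
        (Ideal.Quotient.mk (𝓂[K] ^ m) ⟨a, ha.le⟩ *
          Ideal.quotientMap (𝓂[K] ^ m) ((σ.comp 𝒪[K].subtype).codRestrict 𝒪[K] hσO)
            (maximalIdeal_pow_le_comap_codRestrict σ hd.vϖ hd.vσ hσO m) (Ideal.Quotient.mk (𝓂[K] ^ m) ⟨a, ha.le⟩)) =
        Ideal.Quotient.mk (𝓂[K] ^ k) r := by
  have hσa : Valued.v (σ a) ≤ 1 := by rw [hd.vσ]; exact ha.le
  have hn1 : Valued.v (a * σ a) = 1 := by rw [map_mul, hd.vσ, ha, mul_one]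
  have hn0 : a * σ a ≠ 0 := fun h => by rw [h, map_zero] at hn1; exact zero_ne_one hn1
  have he0 : e ≠ 0 := fun h => by rw [h, map_zero] at he; exact zero_ne_one he
  -- `|n⁻¹ + e| = |n − r|`
  have hfac : (a * σ a)⁻¹ + e = (a * σ a)⁻¹ * e * ((a * σ a) - r) := by
    have : (a * σ a)⁻¹ * e * ((a * σ a) - r) = e * ((a * σ a)⁻¹ * (a * σ a)) - (a * σ a)⁻¹ * ((r : K) * e) := by ring
    rw [this, inv_mul_cancel₀ hn0, hr]; ring
  have hval : Valued.v ((a * σ a)⁻¹ + e) = Valued.v ((a * σ a) - r) := by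
    rw [hfac, map_mul, map_mul, map_inv₀, hn1, he, inv_one, one_mul, one_mul]
  set nO : 𝒪[K] := ⟨a, ha.le⟩ * ⟨σ a, hσa⟩ with hnO
  have hcoe : ((nO - r : 𝒪[K]) : K) = a * σ a - r := by simp [hnO]
  have hσmk : Ideal.quotientMap (𝓂[K] ^ m) ((σ.comp 𝒪[K].subtype).codRestrict 𝒪[K] hσO)
      (maximalIdeal_pow_le_comap_codRestrict σ hd.vϖ hd.vσ hσO m) (Ideal.Quotient.mk (𝓂[K] ^ m) ⟨a, ha.le⟩) =
      Ideal.Quotient.mk (𝓂[K] ^ m) ⟨σ a, hσa⟩ := by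
    rw [Ideal.quotientMap_mk]; rfl
  rw [hval, hσmk, ← map_mul, ← hnO, Ideal.Quotient.factor_mk, Ideal.Quotient.eq, mem_maximalIdeal_pow_iff_v_le hd.vϖ, hcoe]

/-! ## §2 The coset count of cases (b)∕(d) over the CORE-0 criterion -/

section Count

variable [IsDiscreteValuationRing 𝒪[K]] [Finite (ResidueField 𝒪[K])] [IsAdicComplete (maximalIdeal 𝒪[K]) 𝒪[K]]

/-- **PROP. 13, CASES (b)∕(d), AS A COSET COUNT over the CORE-0 criterion.**  Let `τ ∈ U` and suppose that for every `p = p(u,x,w) ∈ P_H`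
**`p⁻¹ τ p ∈ H^K_m ↔ |(uσu)⁻¹ + e| ≤ |ϖ^k| ∧ |x| ≤ |ϖ^k|`** (binder `hbd`; `e` a `σ`-fixed unit, `1 ≤ k ≤ m` — CORE-0's criterion of the printed cases (b)∕(d) with
`e = (A−b)∕B`, `k = m − [N∕2]`).  Then, `F` denoting the common size of the fibres of `ρ_m` on the coset space (binder `hfib`; `= q^m` by (H2)),
`#{y ∈ P_H ⧸ (P_H ∩ H^K_m) : y⁻¹ τ y ∈ H^K_m} = F · ((q^{m−k} · q^{m−1}(q+1)) · q^{m−k})` — Flicker's «`#{u ; uū ∈ 1 + π^{k}R} = (1+q⁻¹)q^{2m−k}` times the number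
`q^{2m−k}` of the `λ`», i.e. `(1+q⁻¹)q^{2m+2[N∕2]}`.  Route = ★ `natCard_cosets_regime_four`'s: count through `ρ_m` (★ `natCard_subtype_comp_eq_mul`), range by ★ (H1)(H3), the
pair count ★ `natCard_pairs_norm_congr_antifixed_zero` at `R = 𝒪[K]`, `r = −e⁻¹`. [cite: Flicker1998UnitaryFL, Prop. 13 p. 93; Prop. 8 p. 84] -/
theorem natCard_cosets_of_iff_small (hJ : J = (StdForm.antidiagonal 3).over K) (hd : LocalConjDatum σ ϖ)
    (hσO : ∀ y : 𝒪[K], (σ.comp 𝒪[K].subtype) y ∈ 𝒪[K]) {m k : ℕ} (hm : 1 ≤ m) (hk : 1 ≤ k) (hkm : k ≤ m)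
    {c um τ : ↥(unitaryGroupOfForm σ J)} (hc : ((c : GL (Fin 3) K) : Matrix (Fin 3) (Fin 3) K) = !![1, 0, 0; 0, -1, 0; 0, 0, 1])
    {e : K} (he : Valued.v e = 1) (hσe : σ e = e)
    (hbd : ∀ p ∈ flickerPH σ J c, ∀ u x w : K,
      ((p : GL (Fin 3) K) : Matrix (Fin 3) (Fin 3) K) = !![u, 0, u * x; 0, w, 0; 0, 0, (σ u)⁻¹] →
        (p⁻¹ * τ * p ∈ flickerHK σ J c um ↔ Valued.v ((u * σ u)⁻¹ + e) ≤ Valued.v (ϖ ^ k) ∧ Valued.v x ≤ Valued.v (ϖ ^ k)))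
    {q : ℕ} (hq : Nat.card (ResidueField 𝒪[K]) = q ^ 2)
    {a₀ : 𝒪[K]} (ha₀ : IsUnit (((σ.comp 𝒪[K].subtype).codRestrict 𝒪[K] hσO) a₀ - a₀))
    (hSN : flickerPH σ J c ⊓ flickerHK σ J c um ≤ flickerPH0 σ J c (ϖ ^ m))
    [Finite (↥(flickerPH σ J c) ⧸ (flickerHK σ J c um).subgroupOf (flickerPH σ J c))] {F : ℕ}
    (hfib : ∀ z ∈ Set.range (fun w : ↥(flickerPH σ J c) ⧸ (flickerHK σ J c um).subgroupOf (flickerPH σ J c) =>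
        flickerPHRho σ m ((Quotient.out w : ↥(flickerPH σ J c)) : ↥(unitaryGroupOfForm σ J))),
      Nat.card {w : ↥(flickerPH σ J c) ⧸ (flickerHK σ J c um).subgroupOf (flickerPH σ J c) //
        flickerPHRho σ m ((Quotient.out w : ↥(flickerPH σ J c)) : ↥(unitaryGroupOfForm σ J)) = z} = F) :
    Nat.card {w : ↥(flickerPH σ J c) ⧸ (flickerHK σ J c um).subgroupOf (flickerPH σ J c) //
      ((Quotient.out w : ↥(flickerPH σ J c)) : ↥(unitaryGroupOfForm σ J))⁻¹ * τ * (Quotient.out w : ↥(flickerPH σ J c)) ∈ flickerHK σ J c um} =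
      F * ((q ^ (m - k) * (q ^ (m - 1) * (q + 1))) * q ^ (m - k)) := by
  classical
  have h2v : Valued.v (2 : K) = 1 := hd.v2
  have h2 : (2 : K) ≠ 0 := fun h => by rw [h, map_zero] at h2v; exact zero_ne_one h2v
  have he0 : e ≠ 0 := fun h => by rw [h, map_zero] at he; exact zero_ne_one he
  -- the restricted involution and the data in `𝒪[K]`
  set σO : 𝒪[K] →+* 𝒪[K] := (σ.comp 𝒪[K].subtype).codRestrict 𝒪[K] hσO with hσOdef
  have hσOσO : ∀ z, σO (σO z) = z := fun z => Subtype.ext (hd.σσ (z : K))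
  have hrv : Valued.v (-e⁻¹) ≤ 1 := by rw [Valuation.map_neg, map_inv₀, he, inv_one]
  set r : 𝒪[K] := ⟨-e⁻¹, hrv⟩ with hrdef
  have hre : (r : K) * e = -1 := by show -e⁻¹ * e = -1; rw [neg_mul, inv_mul_cancel₀ he0]
  have hru : IsUnit r := (Valuation.Integers.isUnit_iff_valuation_eq_one (Valuation.integer.integers _)).2
    (by show Valued.v (-e⁻¹) = 1; rw [Valuation.map_neg, map_inv₀, he, inv_one])
  have hσr : σO r = r := Subtype.ext (by show σ (-e⁻¹) = -e⁻¹; rw [map_neg, map_inv₀, hσe])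
  -- the predicate counted by the pair count, and the map `f = ρ_m ∘ out`
  set P := flickerPH σ J c with hPdef
  set S := (flickerHK σ J c um).subgroupOf (flickerPH σ J c) with hSdef
  set f : ↥P ⧸ S → (𝒪[K] ⧸ 𝓂[K] ^ m) × (𝒪[K] ⧸ 𝓂[K] ^ m) :=
    fun w => flickerPHRho σ m ((Quotient.out w : ↥P) : ↥(unitaryGroupOfForm σ J)) with hfdef
  set Q : (𝒪[K] ⧸ 𝓂[K] ^ m) × (𝒪[K] ⧸ 𝓂[K] ^ m) → Prop := fun ux =>
    IsUnit ux.1 ∧ (Ideal.Quotient.factor (Ideal.pow_le_pow_right hkm)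
        (ux.1 * Ideal.quotientMap (maximalIdeal 𝒪[K] ^ m) σO (maximalIdeal_pow_le_comap σO hσOσO m) ux.1) =
          Ideal.Quotient.mk (maximalIdeal 𝒪[K] ^ k) r ∧
      Ideal.quotientMap (maximalIdeal 𝒪[K] ^ m) σO (maximalIdeal_pow_le_comap σO hσOσO m) ux.2 = -ux.2 ∧
      Ideal.Quotient.factor (Ideal.pow_le_pow_right hkm) ux.2 = 0) with hQdef
  have hσbar : Ideal.quotientMap (maximalIdeal 𝒪[K] ^ m) σO (maximalIdeal_pow_le_comap σO hσOσO m) =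
      Ideal.quotientMap (𝓂[K] ^ m) ((σ.comp 𝒪[K].subtype).codRestrict 𝒪[K] hσO) (maximalIdeal_pow_le_comap_codRestrict σ hd.vϖ hd.vσ hσO m) := rfl
  -- Step A: «good» ⟺ `Q ∘ f`
  have stepA : ∀ w : ↥P ⧸ S, ((Quotient.out w : ↥P) : ↥(unitaryGroupOfForm σ J))⁻¹ * τ * (Quotient.out w : ↥P) ∈ flickerHK σ J c um ↔ Q (f w) := by
    intro w
    set pp : ↥(unitaryGroupOfForm σ J) := ((Quotient.out w : ↥P) : ↥(unitaryGroupOfForm σ J)) with hpp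
    have hp : pp ∈ flickerPH σ J c := (Quotient.out w).2
    obtain ⟨u, x, wc, hpm, hvu, hvx, hσx, hvw, hσw⟩ := exists_coe_eq_borel_of_mem_flickerPH σ hJ hd hc hp
    have hu0 : u ≠ 0 := fun h => by rw [h, map_zero] at hvu; exact zero_ne_one hvu
    have hw0 : wc ≠ 0 := fun h => by rw [h, map_zero] at hvw; exact zero_ne_one hvw
    have hva : Valued.v (u * wc⁻¹) = 1 := by rw [map_mul, map_inv₀, hvu, hvw, inv_one, one_mul]
    have hρ : f w = (Ideal.Quotient.mk (𝓂[K] ^ m) ⟨u * wc⁻¹, hva.le⟩, Ideal.Quotient.mk (𝓂[K] ^ m) ⟨x, hvx⟩) := by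
      show flickerPHRho σ m pp = _
      rw [flickerPHRho_of_coe_eq σ m hpm hu0, toQuotPow_of_le m hva.le, toQuotPow_of_le m hvx]
    have hQ1 : Ideal.quotientMap (maximalIdeal 𝒪[K] ^ m) σO (maximalIdeal_pow_le_comap σO hσOσO m) (f w).2 = -(f w).2 := by
      rw [hσbar]; exact quotientMap_flickerPHRho_snd σ hJ hd hσO hc m hp
    have hQ2 : IsUnit (f w).1 := isUnit_flickerPHRho_fst σ hJ hd hc m hp
    rw [hbd pp hp u x wc hpm]
    -- rewrite `uσu = N(u w⁻¹)`
    have hσwc : σ wc = wc⁻¹ := eq_inv_of_mul_eq_one_left hσw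
    have hN : u * σ u = (u * wc⁻¹) * σ (u * wc⁻¹) := by
      rw [map_mul, map_inv₀, hσwc, inv_inv]; field_simp
    rw [hN, v_inv_add_le_iff_factor_norm_eq σ hd hσO hkm hva he r hre, ← factor_mk_eq_zero_iff hd.vϖ hkm ⟨x, hvx⟩]
    rw [hρ] at hQ1 hQ2
    rw [hQdef, hρ]
    exact ⟨fun h => ⟨hQ2, h.1, hQ1, h.2⟩, fun h => ⟨h.2.1, h.2.2.2⟩⟩
  -- Step B: count through `f`
  rw [Nat.card_congr (Equiv.subtypeEquivRight stepA), natCard_subtype_comp_eq_mul f Q F hfib]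
  congr 1
  -- Step C: the range condition is implied by `Q` (★ (H3) surjectivity + (H1) + `S ≤ N₀`)
  have stepC : ∀ z, Q z → z ∈ Set.range f := by
    rintro ⟨α, β⟩ ⟨hα, -, hβ, -⟩
    obtain ⟨a, rfl⟩ := Ideal.Quotient.mk_surjective α
    obtain ⟨bb, rfl⟩ := Ideal.Quotient.mk_surjective β
    have hau : IsUnit a := isUnit_of_isUnit_mk_pow (R := 𝒪[K]) hm hα
    have hav : Valued.v (a : K) = 1 := (Valuation.Integers.isUnit_iff_valuation_eq_one (Valuation.integer.integers _)).1 hau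
    rw [hσbar] at hβ
    obtain ⟨pp, hpp, hρ⟩ := exists_mem_flickerPH_flickerPHRho_eq σ hJ hd hσO hc m a bb hav hβ
    refine ⟨QuotientGroup.mk ⟨pp, hpp⟩, ?_⟩
    obtain ⟨s, hs'⟩ := QuotientGroup.mk_out_eq_mul S (⟨pp, hpp⟩ : ↥P)
    show flickerPHRho σ m ((Quotient.out (QuotientGroup.mk (⟨pp, hpp⟩ : ↥P) : ↥P ⧸ S) : ↥P) : ↥(unitaryGroupOfForm σ J)) = _
    rw [hs', Subgroup.coe_mul, ← hρ]
    symm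
    rw [flickerPHRho_eq_iff σ hJ hd hc m hpp (Subgroup.mul_mem _ hpp (s : ↥P).2), ← mul_assoc, inv_mul_cancel, one_mul]
    exact hSN ⟨(s : ↥P).2, s.2⟩
  rw [Nat.card_congr (Equiv.subtypeEquivRight fun z => (and_iff_right_of_imp (stepC z) : z ∈ Set.range f ∧ Q z ↔ Q z))]
  -- Step D: `IsUnit` is implied by the norm congruence; then the pair count at `R = 𝒪[K]`
  have hunit : ∀ z : (𝒪[K] ⧸ 𝓂[K] ^ m) × (𝒪[K] ⧸ 𝓂[K] ^ m),
      Ideal.Quotient.factor (Ideal.pow_le_pow_right hkm)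
          (z.1 * Ideal.quotientMap (maximalIdeal 𝒪[K] ^ m) σO (maximalIdeal_pow_le_comap σO hσOσO m) z.1) =
        Ideal.Quotient.mk (maximalIdeal 𝒪[K] ^ k) r → IsUnit z.1 := by
    rintro ⟨α, β⟩ hnorm
    obtain ⟨a, rfl⟩ := Ideal.Quotient.mk_surjective α
    change Ideal.Quotient.factor _ (Ideal.Quotient.mk _ a * _) = _ at hnorm
    rw [Ideal.quotientMap_mk, ← map_mul, Ideal.Quotient.factor_mk, Ideal.Quotient.eq] at hnorm
    have hsub : a * σO a - r ∈ 𝓂[K] := Ideal.pow_le_self (by omega) hnorm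
    have hau : IsUnit a := by
      by_contra hnu
      have ham : a ∈ 𝓂[K] := (mem_maximalIdeal _).2 hnu
      have hnm : a * σO a ∈ 𝓂[K] := Ideal.mul_mem_right _ _ ham
      have hrm : r ∈ 𝓂[K] := by
        have := Ideal.sub_mem _ hnm hsub; rwa [sub_sub_cancel] at this
      exact (mem_maximalIdeal _).1 hrm hru
    exact hau.map _
  rw [Nat.card_congr (Equiv.subtypeEquivRight fun z => (and_iff_right_of_imp (fun h => hunit z h.1) :
    Q z ↔ (Ideal.Quotient.factor (Ideal.pow_le_pow_right hkm)
        (z.1 * Ideal.quotientMap (maximalIdeal 𝒪[K] ^ m) σO (maximalIdeal_pow_le_comap σO hσOσO m) z.1) =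
          Ideal.Quotient.mk (maximalIdeal 𝒪[K] ^ k) r ∧
      Ideal.quotientMap (maximalIdeal 𝒪[K] ^ m) σO (maximalIdeal_pow_le_comap σO hσOσO m) z.2 = -z.2 ∧
      Ideal.Quotient.factor (Ideal.pow_le_pow_right hkm) z.2 = 0)))]
  exact natCard_pairs_norm_congr_antifixed_zero σO hσOσO ha₀ hq hk hkm hru hσr

end Count

end UnitaryGroup

end Literature.NumberTheory.Automorphic
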